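import Literature.MathematicalPhysics.QuantumFieldTheory.Balaban1983to89.B3Ineq210ZeroTorus

/-!
# `Balaban1983to89.B3Ineq212ZeroTorus` — T. Bałaban, *(Higgs)₂,₃ quantum fields in a finite volume. III. Renormalization*,
# Commun. Math. Phys. **88** (1983) 411–445 [Balaban1983Higgs3]: the bound (2.12) p. 426 for the scale pieces with a leg
# averaged along the composite contours `Γ^{(j+1)}_{x_{j+1},x}` of [Balaban1982Higgs1] (2.1)–(2.2),
# `|G^η_{(j)}(Γ^{(j+1)}_{x_{j+1},x}, b)| ≤ O(1)(L^jη)^{−d+3}e^{−δ₁(L^jη)^{−1}dist(B^j(x),b)}` («an additional factor L^jη»), PROVED for the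
# TORUS MODEL INSTANCE `A = B̃ = 0`, `Ω = T_η`: the contours typed with bodies ON THE TORUS `T^{(0)}` and counted, and
# `ScaledKernels.Ineq212 δ₁ C` DISCHARGED for the concrete carrier `zeroTorusKernelsV`, hypothesis-free and volume-uniform

statement-level skeleton of published theorems with citation tags; proofs where landed; nothing here is a claim about the Yang–Mills mass gap

PDF held: `paper:balaban1983-higgs-2-3-quantum-fields-finite-volume` (journal page = PDF page + 410); p. 426 [PDF 16] (2.12) read in the
OCR text (`p0016.txt`) and on the render `run/shared/lean/pub/pub-balaban/b2b-balaban-ref1/pages/1983-cmp88-higgs23-III/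
1983-cmp88-higgs23-III-p016-x2.png`; [B1] = T. Bałaban, *(Higgs)₂,₃ quantum fields in a finite volume. I*, CMP **85** (1982)
[Balaban1982Higgs1], (2.1)–(2.2) p. 608 (the contours `Γ_{y,x}`, `Γ^{(k)}_{y,x}`), as quoted by `B3Ineq212ZeroBox`.

CITATION HEADER (lean-in-tree rule).  Part of the lit-balaban TYPED SKELETON (HOME `run/shared/lean/pub/lit-balaban/`), Phase 2:
SKELETON row **B3.Eq2.12** (`HOME/lit-balaban-r15/ROWS-B3.md`, fold owner r15; decl of record `B3Sect2StatementsPart2.ScaledKernels.Ineq212`,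
typed p239134, over the ABSTRACT carrier `ScaledKernels`).  TORUS TWIN of this seat's `B3Ineq212ZeroBox` (p254210: the same row for
Neumann boxes `Ω = □`, contours in `ℤ^{d}`); a thin assembly over this seat's `B3Ineq210ZeroTorus` (p258063: the torus pieces `pieceT`,
the carrier `zeroTorusKernels`, **(2.10) on the torus `ineq210_zeroTorus`**, hypothesis-free) and the torus geometry of
`B5Ineq137Torus` / `B5Leaf237C0Torus` (`fine`, `blk`, `T_le_of_proj_eq`, the sup torus metric `T`); nothing of these is re-proved.

WHAT IS PRINTED (B3 p. 426): *"If a leg A′ of the line is in one of the vertices (1.14) and (1.15), then we have the expression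
A′^{(j),η}(Γ^{j+1}_{x_{j+1},x}) on the basis of (1.3). For each such expression we have an additional factor L^jη on the right side,
e.g. we have |G^η_{(j)}(Γ^{(j+1)}_{x_{j+1},x}, b)| ≤ O(1)(L^jη)^{−d+3}e^{−δ₁(L^jη)^{−1}dist(B^j(x),b)}. (2.12)"*; [B1] p. 608: *"Γ_{y,x} =
⟨y, (y₁, …, y_{d−1}, x_d)⟩ ∪ ⟨(y₁, …, y_{d−1}, x_d), (y₁, …, y_{d−2}, x_{d−1}, x_d)⟩ … ∪ ⟨(y₁, x₂, …, x_d), x⟩ … (2.1)"*, *"Γ^{(k)}_{y,x} =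
Γ_{y,x_{k−1}} ∪ Γ_{x_{k−1},x_{k−2}} ∪ … ∪ Γ_{x_1,x} (2.2)"* with `x ∈ B^j(x_j)`.

WHAT IS REPRODUCED (kind «model-instance», G.1 of `HOME/PHASE2-TARGETS.md`).  On Bałaban's CONCRETE scalar torus tower
`B1RG242Torus.tower P a msq` (volume `P = (d, L, m, K)`, finest torus `T^{(0)} = Site P 0`, `η = ε = L^{−K}`, `U ≡ 1`):
* §1 the composite contours ON THE TORUS, typed with bodies: the corners `cornerT P i x = x_i` (`fine P i (blk P i x)`: the point of
  `T^{(i)}` with `x ∈ B^i(x_i)`, corner representative), the base points `segPt` of the positively oriented fine bonds of the staircase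
  `Γ_{x_{i+1},x_i}` (direction `μ`: coordinates `< μ` from `x_{i+1}`, `> μ` from `x_i`, the `μ`-th running from `(x_{i+1})_μ` up), their
  number `nsteps P i x μ = (x_i)_μ − (x_{i+1})_μ`, `stairT`, and `contourT P n x = Γ^{(n)}_{x_n,x}` as a finite set of fine bonds
  `(base point, direction)`;
* §2 the contour geometry: `nsteps_le` (`≤ L^i(L−1)`), **`card_contourT_le`** (`#Γ^{(n)}_{x_n,x} ≤ d·L^n`), `blk_segPt` (every bond of
  `Γ^{(n)}_{x_n,x}` lies in the block `B^n(x)`), **`T_contourT_le`** (`|z − x|_T ≤ L^{j+1} − 1` for the base points `z`);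
* §3 the averaged leg: `vecPieceT` (`δ_{νμ}G_{(j)}(z, x_b)`, the `d` components of the `A = 0` vector field being independent copies of
  the scalar field, [B1] p. 608 «N = d and an external vector field A = 0»), `gsumT` (`Σ_{b′⊂Γ^{(j+1)}_{x_{j+1},x}} η·δ_{ν(b′)μ(b)}G_{(j)}(z(b′),x_b)`
  — the leg `A′^{(j),η}(Γ^{(j+1)}_{x_{j+1},x}) = Σ_{b′⊂Γ}ηA′_{b′}` of (1.3) contracted with `A′_b`), the block point set `blockSitesT` and
  `distBlockT j x b = η·dist_T(B^j(x), b)` with `distBlockT_le` (`≤ η|x − x_b|_T`);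
* §4 the CARRIER `zeroTorusKernelsV P a msq k : ScaledKernels` (`Bond = Site P 0 × Fin d`, `absGavg = η^{−d}|gsumT|`, `distBlock = distBlockT`,
  the (2.10) fields of `zeroTorusKernels`; (2.5)/(2.11) fields `0`), `ineq210_iff_V`, and **`ineq212_zeroTorusV`**: for `d ≥ 1`, odd
  `L > 1`, `a > 0`, `m² ≥ 0`, `∃ δ₁ C > 0` (functions of `d, L, a, m²`) such that for EVERY volume with these `d, L` and every scale
  `1 ≤ k ≤ K`, `(zeroTorusKernelsV P a msq k).Ineq212 δ₁ C`; `ineq210_and_212_zeroTorusV`; §5 a witness volume.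

HONEST SCOPE / DECLARED DIVERGENCES (F7).  (i) `A = B̃ = 0` (`U ≡ 1`), `Ω = T_η` the WHOLE torus; the vector-field pieces at `A = 0`
are `δ_{νμ}` times the scalar pieces ([B1] p. 608), as in `B3Ineq212ZeroBox`.  (ii) `|·|` = the sup torus distance `B5Ineq137Torus.T` in
fine units times `η`; `dist(B^j(x), b)` = `η·min_{z ∈ B^j(x)} min(|z − x_b|_T, |z − (x_b + e_μ)|_T)` (both end-points of `b`).  (iii) The
contour `Γ^{(j+1)}_{x_{j+1},x}` is typed on the torus through the coordinates `val ∈ [0, 2L^{m+K})` (the corner-anchored blocks of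
`TorusGeometry`/`B5Ineq137Torus`): all its bonds lie in `B^{j+1}(x)`, so no wrap-around occurs for `j + 1 ≤ m + K`.  (iv) Mass and `a`:
FIXED `a > 0`, `m² ≥ 0`; constants depend on `d, L, a, m²`, uniform in `(m, K)`, `k ≤ K`, `j`; existential.  (v) ROUTE = the print's
(«an additional factor L^jη»: at most `d·L^{j+1}` bonds of weight `η` each, times (2.10)); (2.10) on the torus is `ineq210_zeroTorus`
(p258063) BY NAME; no Literature fact minted (`cornerT`, `segPt`, `stairT`, `contourT`, `vecPieceT`, `gsumT`, `blockSitesT`, `distBlockT`,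
`zeroTorusKernelsV` are concrete `def`s; the theorems are proved); standard axioms.  Value = kernel certificate of a located
by-reference step of B3 on the paper's own lattice `T_η` at zero background, NOT summit progress.
Unit `lit-balaban-p03-g4` (Phase-2 proof seat p03, gen 4); HOME `run/shared/lean/pub/lit-balaban/` (row B3.Eq2.12, FILED.md, STATUS.md).
-/

namespace Literature.MathematicalPhysics.QuantumFieldTheory.Balaban1983to89.B3Ineq212ZeroTorus

open Matrix B1RG242Torus B5Display136Torus B5Leaf237C0Torus B4Ineq115Torus B5Ineq137Torus B4Ineq116Torus B4Thm110ZeroTorus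
open B5Leaf235Torus (blk_eq_proj)
open B3Sect2StatementsPart2 B3Ineq210ZeroTorus

noncomputable section

variable (P : Params)

/-! ## §1 The composite contours `Γ^{(n)}_{x_n,x}` of [Balaban1982Higgs1] (2.1)–(2.2) on the torus `T^{(0)}` -/

/-- The corner `x_i ∈ T^{(i)}` with `x ∈ B^i(x_i)` ([B1] (2.2): *"Let us denote by x_j a point of torus T^{(j)}_{L^jε}, such that
x ∈ B^j(x_j)"*), read in `T^{(0)}` through its corner representative (`fine P i (blk P i x)`: coordinates `L^i⌊x_μ/L^i⌋`).
[cite: Balaban1982Higgs1, (2.2) p.608] -/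
def cornerT (i : ℕ) (x : Site P 0) : Site P 0 := fine P i (blk P i x)

/-- The number of fine bonds of direction `μ` on the staircase `Γ_{x_{i+1},x_i}`: `(x_i)_μ − (x_{i+1})_μ` (lattice units).
[cite: Balaban1982Higgs1, (2.1)–(2.2) p.608] -/
def nsteps (i : ℕ) (x : Site P 0) (μ : Fin P.d) : ℕ := (cornerT P i x μ).val - (cornerT P (i + 1) x μ).val

/-- The base point of the `t`-th bond of direction `μ` of the staircase `Γ_{p,q}` of [B1] (2.1) from `p` up to `q`: coordinates
`ν < μ` from `p`, `ν > μ` from `q` (already moved — (2.1) moves the last coordinate first), the `μ`-th equal to `p_μ + t`.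
[cite: Balaban1982Higgs1, (2.1) p.608] -/
def segPt (p q : Site P 0) (μ : Fin P.d) (t : ℕ) : Site P 0 :=
  fun ν => if ν < μ then p ν else if ν = μ then p μ + (t : ZMod (P.sitesPerDir 0)) else q ν

/-- The staircase `Γ_{x_{i+1},x_i}` of [B1] (2.1), verbatim: *"Γ_{y,x} = ⟨y, (y₁, …, y_{d−1}, x_d)⟩ ∪ … ∪ ⟨(y₁, x₂, …, x_d), x⟩ … Each such
contour is composed of the bonds of ε-lattice"*, as a set of positively oriented fine bonds `(base point, direction)`.
[cite: Balaban1982Higgs1, (2.1) p.608] -/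
def stairT (i : ℕ) (x : Site P 0) : Finset (Site P 0 × Fin P.d) :=
  Finset.univ.biUnion fun μ =>
    (Finset.range (nsteps P i x μ)).image fun t => (segPt P (cornerT P (i + 1) x) (cornerT P i x) μ t, μ)

/-- The composite contour `Γ^{(n)}_{x_n,x} = Γ_{x_n,x_{n−1}} ∪ … ∪ Γ_{x_1,x}` of [B1] (2.2) (`x_0 = x`), as a set of fine bonds of `T^{(0)}`.
[cite: Balaban1982Higgs1, (2.2) p.608] -/
def contourT (n : ℕ) (x : Site P 0) : Finset (Site P 0 × Fin P.d) :=
  (Finset.range n).biUnion fun i => stairT P i x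

/-! ## §2 Contour geometry: the number of bonds and the block containing them -/

section Geometry

/-- kernel: the corner coordinates `(x_i)_μ = L^i⌊x_μ/L^i⌋` (no wrap-around for `i ≤ m + K`). [folklore] -/
private theorem corner_val {i : ℕ} (hi : i ≤ P.m + P.K) (x : Site P 0) (ν : Fin P.d) :
    (cornerT P i x ν).val = P.L ^ i * ((x ν).val / P.L ^ i) := by
  unfold cornerT
  rw [fine_val P hi, blk_val P hi]

/-- kernel: `L^{a+1}⌊v/L^{a+1}⌋ ≤ L^a⌊v/L^a⌋`. [folklore] -/
private theorem floor_mono (v a : ℕ) : P.L ^ (a + 1) * (v / P.L ^ (a + 1)) ≤ P.L ^ a * (v / P.L ^ a) := by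
  rw [pow_succ, mul_assoc, ← Nat.div_div_eq_div_mul]
  exact Nat.mul_le_mul_left _ (Nat.mul_div_le (v / P.L ^ a) P.L)

/-- kernel: `L^i(L − 1) + L^i = L^{i+1}`. [folklore] -/
private theorem pow_mul_pred_add (i : ℕ) : P.L ^ i * (P.L - 1) + P.L ^ i = P.L ^ (i + 1) := by
  rw [pow_succ, ← Nat.mul_succ, Nat.succ_eq_add_one, Nat.sub_add_cancel P.L_pos]

/-- The corner coordinates decrease with the level: `(x_{i+1})_μ ≤ (x_i)_μ`. [cite: Balaban1982Higgs1, (2.2) p.608] -/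
theorem corner_val_succ_le {i : ℕ} (hi : i + 1 ≤ P.m + P.K) (x : Site P 0) (μ : Fin P.d) :
    (cornerT P (i + 1) x μ).val ≤ (cornerT P i x μ).val := by
  rw [corner_val P hi, corner_val P (by omega)]
  exact floor_mono P _ _

/-- The number of bonds of direction `μ` on `Γ_{x_{i+1},x_i}` is `≤ L^i(L − 1)` (`= L^i·(⌊x_μ/L^i⌋ mod L)`).
[cite: Balaban1982Higgs1, (2.1)–(2.2) p.608] -/
theorem nsteps_le {i : ℕ} (hi : i + 1 ≤ P.m + P.K) (x : Site P 0) (μ : Fin P.d) :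
    nsteps P i x μ ≤ P.L ^ i * (P.L - 1) := by
  unfold nsteps
  rw [corner_val P (by omega) x μ, corner_val P hi x μ]
  set q := (x μ).val / P.L ^ i with hq
  have hq' : (x μ).val / P.L ^ (i + 1) = q / P.L := by rw [pow_succ, ← Nat.div_div_eq_div_mul]
  rw [hq', Nat.sub_le_iff_le_add]
  have hdm := Nat.div_add_mod q P.L
  have hr : q % P.L ≤ P.L - 1 := Nat.le_sub_one_of_lt (Nat.mod_lt q P.L_pos)
  calc P.L ^ i * q = P.L ^ i * (P.L * (q / P.L) + q % P.L) := by rw [hdm]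
    _ = P.L ^ (i + 1) * (q / P.L) + P.L ^ i * (q % P.L) := by rw [pow_succ]; ring
    _ ≤ P.L ^ (i + 1) * (q / P.L) + P.L ^ i * (P.L - 1) := Nat.add_le_add_left (Nat.mul_le_mul_left _ hr) _
    _ = P.L ^ i * (P.L - 1) + P.L ^ (i + 1) * (q / P.L) := add_comm _ _

/-- Hence fewer than `L^{i+1}` bonds per direction. [cite: Balaban1982Higgs1, (2.1)–(2.2) p.608] -/
theorem nsteps_lt {i : ℕ} (hi : i + 1 ≤ P.m + P.K) (x : Site P 0) (μ : Fin P.d) : nsteps P i x μ < P.L ^ (i + 1) := by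
  have h := nsteps_le P hi x μ
  have h1 : 1 ≤ P.L ^ i := Nat.one_le_pow _ _ P.L_pos
  have h2 := pow_mul_pred_add P i
  omega

/-- kernel: `Σ_{i<n} L^i(L − 1) + 1 = L^n`. [folklore] -/
private theorem geom_sum_nat (n : ℕ) : ∑ i ∈ Finset.range n, P.L ^ i * (P.L - 1) + 1 = P.L ^ n := by
  induction n with
  | zero => simp
  | succ n ih =>
    rw [Finset.sum_range_succ, add_right_comm, ih]
    have := pow_mul_pred_add P n
    omega

/-- **THE NUMBER OF BONDS of `Γ^{(n)}_{x_n,x}` is at most `d·L^n`** (direction by direction the staircases telescope: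
`Σ_{i<n} L^i(L−1) = L^n − 1` bonds of each direction at most) — the source of «an additional factor L^jη» in (2.12).
[cite: Balaban1983Higgs3, (2.12) p.426; Balaban1982Higgs1, (2.1)–(2.2) p.608] -/
theorem card_contourT_le {n : ℕ} (hn : n ≤ P.m + P.K) (x : Site P 0) : (contourT P n x).card ≤ P.d * P.L ^ n := by
  unfold contourT
  refine Finset.card_biUnion_le.trans ?_
  have hst : ∀ i ∈ Finset.range n, (stairT P i x).card ≤ P.d * (P.L ^ i * (P.L - 1)) := by
    intro i hi
    have hi' : i + 1 ≤ P.m + P.K := by have := Finset.mem_range.1 hi; omega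
    unfold stairT
    refine Finset.card_biUnion_le.trans
      ((Finset.sum_le_sum (g := fun _ => P.L ^ i * (P.L - 1)) fun μ _ => ?_).trans ?_)
    · exact Finset.card_image_le.trans (by rw [Finset.card_range]; exact nsteps_le P hi' x μ)
    · simp
  calc ∑ i ∈ Finset.range n, (stairT P i x).card
      ≤ ∑ i ∈ Finset.range n, P.d * (P.L ^ i * (P.L - 1)) := Finset.sum_le_sum hst
    _ = P.d * ∑ i ∈ Finset.range n, P.L ^ i * (P.L - 1) := by rw [Finset.mul_sum]
    _ ≤ P.d * P.L ^ n := Nat.mul_le_mul_left _ (by have := geom_sum_nat P n; omega)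

/-- The bonds of `Γ^{(n)}_{x_n,x}`, by construction. [cite: Balaban1982Higgs1, (2.1)–(2.2) p.608] -/
theorem mem_contourT {n : ℕ} {x : Site P 0} {b : Site P 0 × Fin P.d} (hb : b ∈ contourT P n x) :
    ∃ i, i < n ∧ ∃ (μ : Fin P.d) (t : ℕ), t < nsteps P i x μ ∧
      b = (segPt P (cornerT P (i + 1) x) (cornerT P i x) μ t, μ) := by
  unfold contourT at hb
  rw [Finset.mem_biUnion] at hb
  obtain ⟨i, hi, hb⟩ := hb
  unfold stairT at hb
  rw [Finset.mem_biUnion] at hb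
  obtain ⟨μ, -, hb⟩ := hb
  rw [Finset.mem_image] at hb
  obtain ⟨t, ht, rfl⟩ := hb
  exact ⟨i, Finset.mem_range.1 hi, μ, t, Finset.mem_range.1 ht, rfl⟩

/-- kernel: `L^a⌊v/L^a⌋/L^n = ⌊v/L^n⌋` (integer division) for `a ≤ n`. [folklore] -/
private theorem mul_div_pow_eq (v : ℕ) {a n : ℕ} (h : a ≤ n) : P.L ^ a * (v / P.L ^ a) / P.L ^ n = v / P.L ^ n := by
  obtain ⟨c, rfl⟩ := Nat.exists_eq_add_of_le h
  rw [pow_add, ← Nat.div_div_eq_div_mul, ← Nat.div_div_eq_div_mul, Nat.mul_div_cancel_left _ (pow_pos P.L_pos a)]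

/-- **Every bond of `Γ^{(n)}_{x_n,x}` lies in the block `B^n(x)`**: the block of level `n` of the base point of the `t`-th bond of
direction `μ` of `Γ_{x_{i+1},x_i}` (`i + 1 ≤ n ≤ m + K`) is the block of `x`. [cite: Balaban1982Higgs1, (2.2) p.608] -/
theorem blk_segPt {n i : ℕ} (hin : i + 1 ≤ n) (hn : n ≤ P.m + P.K) (x : Site P 0) (μ : Fin P.d) {t : ℕ}
    (ht : t < nsteps P i x μ) :
    blk P n (segPt P (cornerT P (i + 1) x) (cornerT P i x) μ t) = blk P n x := by
  have hi1 : i + 1 ≤ P.m + P.K := hin.trans hn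
  have hi0 : i ≤ P.m + P.K := by omega
  funext ν
  apply ZMod.val_injective
  rw [blk_val P hn, blk_val P hn]
  show (if ν < μ then cornerT P (i + 1) x ν
      else if ν = μ then cornerT P (i + 1) x μ + (t : ZMod (P.sitesPerDir 0)) else cornerT P i x ν).val / P.L ^ n
    = (x ν).val / P.L ^ n
  by_cases hlt : ν < μ
  · rw [if_pos hlt, corner_val P hi1 x ν]
    exact mul_div_pow_eq P _ hin
  · rw [if_neg hlt]
    by_cases heq : ν = μ
    · subst heq
      rw [if_pos rfl]
      -- the running coordinate: `L^{i+1}⌊x_ν/L^{i+1}⌋ + t` with `t < nsteps < L^{i+1}`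
      have hmono := corner_val_succ_le P hi1 x ν
      have hlt' : (cornerT P (i + 1) x ν).val + t < P.sitesPerDir 0 := by
        have h1 : (cornerT P (i + 1) x ν).val + t < (cornerT P i x ν).val := by unfold nsteps at ht; omega
        exact h1.trans (ZMod.val_lt _)
      have htN : t < P.sitesPerDir 0 := by omega
      have hval : (cornerT P (i + 1) x ν + (t : ZMod (P.sitesPerDir 0))).val = (cornerT P (i + 1) x ν).val + t := by
        rw [ZMod.val_add_of_lt (by rwa [ZMod.val_natCast_of_lt htN]), ZMod.val_natCast_of_lt htN]
      rw [hval, corner_val P hi1 x ν]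
      have htL : t < P.L ^ (i + 1) := ht.trans (nsteps_lt P hi1 x ν)
      obtain ⟨c, rfl⟩ := Nat.exists_eq_add_of_le hin
      rw [pow_add (P.L) (i + 1) c, ← Nat.div_div_eq_div_mul, ← Nat.div_div_eq_div_mul,
        Nat.mul_add_div (pow_pos P.L_pos _), Nat.div_eq_of_lt htL, add_zero]
    · rw [if_neg heq, corner_val P hi0 x ν]
      exact mul_div_pow_eq P _ (by omega)

/-- **The base points of the bonds of `Γ^{(j+1)}_{x_{j+1},x}` are within `L^{j+1} − 1` of `x`** (sup torus distance, fine units): they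
share the block `B^{j+1}(x)` (`B5Leaf237C0Torus.T_le_of_proj_eq`). [cite: Balaban1982Higgs1, (2.2) p.608] -/
theorem T_contourT_le {j : ℕ} (hj : j + 1 ≤ P.m + P.K) (x : Site P 0) {b : Site P 0 × Fin P.d}
    (hb : b ∈ contourT P (j + 1) x) : T P 0 b.1 x ≤ (P.L : ℝ) ^ (j + 1) - 1 := by
  obtain ⟨i, hi, μ, t, ht, rfl⟩ := mem_contourT P hb
  have hblk := blk_segPt P (by omega : i + 1 ≤ j + 1) hj x μ ht
  rw [blk_eq_proj (P := P) hj, blk_eq_proj (P := P) hj] at hblk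
  have h0 : P.sitesPerDir 0 = P.L ^ (j + 1) * P.sitesPerDir (j + 1) := (pow_mul_sitesPerDir P hj).symm
  exact T_le_of_proj_eq P h0 hblk

end Geometry

/-! ## §3 The averaged vector leg `G^η_{(j)}(Γ^{(j+1)}_{x_{j+1},x}, b)` and the block distance `dist(B^j(x), b)` -/

/-- The scale piece of the VECTOR-field propagator at `A = 0` between the fine bonds `b′ = ⟨z, z+ηe_ν⟩` and `b = ⟨x_b, x_b+ηe_μ⟩`:
`δ_{νμ}·G^η_{(j)}(z, x_b)` ([B1] p. 608: *"The renormalization transformations for vector fields will be obtained by taking N = d and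
an external vector field A = 0"* — the `d` components are independent copies of the scalar field, so (2.6) holds componentwise:
B3 p. 424 *"and the similar equality for the vector field propagator"*). [cite: Balaban1983Higgs3, (2.6) p.424] -/
def vecPieceT (a msq : ℝ) (k j : ℕ) (b' b : Site P 0 × Fin P.d) : ℝ :=
  if b'.2 = b.2 then pieceT P a msq k j b'.1 b.1 else 0

/-- `G^η_{(j)}(Γ^{(j+1)}_{x_{j+1},x}, b)`: the vector leg `A′^{(j),η}(Γ^{(j+1)}_{x_{j+1},x}) = Σ_{b′⊂Γ} ηA′_{b′}` of (1.3) contracted with the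
leg `A′_b` — `Σ_{b′ ⊂ Γ^{(j+1)}_{x_{j+1},x}} η·δ_{ν(b′)μ(b)}G_{(j)}(z(b′), x_b)` (all bonds of `Γ` positively oriented).  B3 p. 426: *"If a leg A′
of the line is in one of the vertices (1.14) and (1.15), then we have the expression A′^{(j),η}(Γ^{j+1}_{x_{j+1},x}) on the basis of (1.3)"*.
[cite: Balaban1983Higgs3, (2.12) p.426] -/
def gsumT (a msq : ℝ) (k j : ℕ) (x : Site P 0) (b : Site P 0 × Fin P.d) : ℝ :=
  ∑ b' ∈ contourT P (j + 1) x, P.eps * vecPieceT P a msq k j b' b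

/-- The block `B^j(x)` of the fine site `x` as a set of fine sites. [cite: Balaban1983Higgs3, (2.12) p.426] -/
def blockSitesT (j : ℕ) (x : Site P 0) : Finset (Site P 0) :=
  Finset.univ.filter fun z => blk P j z = blk P j x

/-- `x ∈ B^j(x)`. [cite: Balaban1983Higgs3, (2.12) p.426] -/
theorem self_mem_blockSitesT (j : ℕ) (x : Site P 0) : x ∈ blockSitesT P j x := by
  simp [blockSitesT]

/-- `dist(B^j(x), b)` (in `η`-units): `η` times the sup torus distance between the point set `B^j(x)` and the two end-points `x_b`,
`x_b + e_μ` of the bond `b`. [cite: Balaban1983Higgs3, (2.12) p.426] -/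
def distBlockT (j : ℕ) (x : Site P 0) (b : Site P 0 × Fin P.d) : ℝ :=
  P.eps * (blockSitesT P j x).inf' ⟨x, self_mem_blockSitesT P j x⟩
    fun z => min (T P 0 z b.1) (T P 0 z (Site.shift b.1 b.2))

/-- `dist(B^j(x), b) ≤ η|x − x_b|_T`. [cite: Balaban1983Higgs3, (2.12) p.426] -/
theorem distBlockT_le (j : ℕ) (x : Site P 0) (b : Site P 0 × Fin P.d) : distBlockT P j x b ≤ P.eps * T P 0 x b.1 := by
  unfold distBlockT
  exact mul_le_mul_of_nonneg_left
    ((Finset.inf'_le _ (self_mem_blockSitesT P j x)).trans (min_le_left _ _)) P.eps_pos.le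

section Leg

variable {P} {a msq : ℝ} {k : ℕ}

/-- `|δ_{νμ}G_{(j)}(z, x_b)| ≤ |G_{(j)}(z, x_b)|`. [cite: Balaban1983Higgs3, (2.12) p.426] -/
theorem abs_vecPieceT_le (j : ℕ) (b' b : Site P 0 × Fin P.d) :
    |vecPieceT P a msq k j b' b| ≤ |pieceT P a msq k j b'.1 b.1| := by
  unfold vecPieceT
  split_ifs
  · exact le_rfl
  · rw [abs_zero]; exact abs_nonneg _

/-- no pieces beyond `j = k − 1`: the averaged leg vanishes for `j ≥ k`. [cite: Balaban1983Higgs3, (2.6) p.424] -/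
theorem gsumT_of_le {j : ℕ} (hj1 : 1 ≤ j) (hkj : k ≤ j) (x : Site P 0) (b : Site P 0 × Fin P.d) :
    gsumT P a msq k j x b = 0 := by
  unfold gsumT
  refine Finset.sum_eq_zero fun b' _ => ?_
  unfold vecPieceT
  rw [pieceT_of_le hj1 hkj]
  simp

end Leg

/-! ## §4 The TORUS carrier with the averaged-leg field and `Ineq212` DISCHARGED, hypothesis-free and volume-uniform -/

/-- **The concrete carrier of B3 (2.10)/(2.12) for the MODEL INSTANCE `A = B̃ = 0`, `Ω = T_η`** at the scale `k` of the volume `P`: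
sites `T^{(0)}`, bonds = positively oriented fine bonds `(base point, direction)`, `dist = η|x−x′|_T`, `absG`/`absDG` as in
`zeroTorusKernels` (`B3Ineq210ZeroTorus`), `absGavg j x b = η^{−d}|G^η_{(j)}(Γ^{(j+1)}_{x_{j+1},x}, b)|` (`gsumT`, `η^d`-normalised) and
`distBlock j x b = dist(B^j(x), b)` (`distBlockT`); the (2.5)/(2.11) fields stay unmodelled (`0`). [cite: Balaban1983Higgs3, (2.10), (2.12) p.426] -/
def zeroTorusKernelsV (P : Params) (a msq : ℝ) (k : ℕ) : ScaledKernels where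
  Site := Site P 0
  Bond := Site P 0 × Fin P.d
  Dir := Fin P.d
  LocFn := PUnit
  dist := fun x x' => P.eps * T P 0 x x'
  dist2 := fun _ _ _ => 0
  distBlock := fun j x b => distBlockT P j x b
  distSupp := fun _ _ => 0
  distΩ₂ := 0
  L := P.L
  η := P.eps
  d := P.d
  eRun := 0
  pRun := 0
  one_lt_L := one_lt_cast_L P
  η_pos := P.eps_pos
  absG := fun j x x' => (P.eps ^ P.d)⁻¹ * |pieceT P a msq k j x x'|
  absDG := fun j μ x x' => (P.eps ^ P.d)⁻¹ * |(deriv P 0 P.eps μ * pieceT P a msq k j) x x'|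
  holderDiff := fun _ _ _ _ _ => 0
  absGavg := fun j x b => (P.eps ^ P.d)⁻¹ * |gsumT P a msq k j x b|
  normDeltaG := fun _ _ _ => 0
  norm116 := fun _ _ _ _ _ => 0

section Carrier

variable {P} {a msq : ℝ} {k : ℕ}

/-- the carrier's `L^jη` is the tower's spacing `L^jε`. [cite: Balaban1983Higgs3, (2.12) p.426] -/
theorem scaleV_eq (j : ℕ) : (zeroTorusKernelsV P a msq k).scale j = P.spacing j := rfl

/-- (2.10) for this carrier IS (2.10) for `zeroTorusKernels` (same sites, distance, scales and kernels).
[cite: Balaban1983Higgs3, (2.10) p.426] -/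
theorem ineq210_iff_V (δ₁ C : ℝ) :
    (zeroTorusKernelsV P a msq k).Ineq210 δ₁ C ↔ (zeroTorusKernels P a msq k).Ineq210 δ₁ C := Iff.rfl

/-- kernel: `(L^jη)^{−1}·(η·t) = t/L^j`. [folklore] -/
private theorem scale_inv_mul' (j : ℕ) (t : ℝ) : (P.spacing j)⁻¹ * (P.eps * t) = t / (P.L : ℝ) ^ j := by
  have hε : P.eps ≠ 0 := P.eps_pos.ne'
  unfold Params.spacing
  rw [mul_inv, div_eq_mul_inv]
  calc ((P.L : ℝ) ^ j)⁻¹ * P.eps⁻¹ * (P.eps * t) = t * ((P.L : ℝ) ^ j)⁻¹ * (P.eps⁻¹ * P.eps) := by ring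
    _ = t * ((P.L : ℝ) ^ j)⁻¹ := by rw [inv_mul_cancel₀ hε, mul_one]

/-- kernel: `(L^jη)·(L^jη)^{2−d} = (L^jη)^{3−d}` (real exponents). [folklore] -/
private theorem spacing_mul_rpow (j : ℕ) :
    P.spacing j * P.spacing j ^ ((2 : ℝ) - (P.d : ℝ)) = P.spacing j ^ ((3 : ℝ) - (P.d : ℝ)) := by
  rw [show (3 : ℝ) - (P.d : ℝ) = 1 + ((2 : ℝ) - (P.d : ℝ)) by ring, Real.rpow_add (P.spacing_pos j), Real.rpow_one]

end Carrier

/-- **B3 (2.12) p. 426 [PDF 16] PROVED FOR THE TORUS MODEL INSTANCE `A = B̃ = 0`, `Ω = T_η`, hypothesis-free and uniform in the volume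
and the scale**: for `d ≥ 1`, odd `L > 1`, `a > 0`, `m² ≥ 0` there are `δ₁ > 0`, `C > 0` (functions of `d, L, a, m²`) such that for EVERY
volume `P = (d, L, m, K)` of Bałaban's scalar torus tower and every scale `1 ≤ k ≤ K`: `(zeroTorusKernelsV P a msq k).Ineq212 δ₁ C`,
i.e. for all `j`, `x ∈ T_η` and fine bonds `b`:
`η^{−d}|G^η_{(j)}(Γ^{(j+1)}_{x_{j+1},x}, b)| ≤ C(L^jη)^{3−d}e^{−δ₁(L^jη)^{−1}dist(B^j(x),b)}`.  Print: *"For each such expression we have an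
additional factor L^jη on the right side, e.g. we have (2.12)."*  Route: exactly that — at most `d·L^{j+1}` bonds (`card_contourT_le`),
each of weight `η` (so `η·d·L^{j+1} = dL·(L^jη)`), each bounded by the value clause of (2.10) on the torus (`ineq210_zeroTorus`), the
bonds lying within `L^{j+1} − 1` of `x` (`T_contourT_le`, paid by `e^{δ₁L}`) and `dist(B^j(x), b) ≤ η|x − x_b|_T` (`distBlockT_le`).
[cite: Balaban1983Higgs3, (2.12) p.426] -/
theorem ineq212_zeroTorusV (d L : ℕ) (hd : 1 ≤ d) (hL : Odd L ∧ 1 < L) {a : ℝ} (ha : 0 < a) {msq : ℝ} (hmsq : 0 ≤ msq) :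
    ∃ δ₁ C : ℝ, 0 < δ₁ ∧ 0 < C ∧ ∀ (P : Params), P.d = d → P.L = L →
      ∀ k : ℕ, 1 ≤ k → k ≤ P.K → (zeroTorusKernelsV P a msq k).Ineq212 δ₁ C := by
  obtain ⟨δ₁, C, hδ₁, hC, h210⟩ := ineq210_zeroTorus d L hd hL ha hmsq
  have hd0 : (0 : ℝ) < d := by exact_mod_cast hd
  have hL0 : (0 : ℝ) < L := by exact_mod_cast (zero_lt_one.trans hL.2)
  refine ⟨δ₁, (d : ℝ) * (L : ℝ) * C * Real.exp (δ₁ * L), hδ₁, by positivity, ?_⟩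
  intro P hPd hPL k hk1 hkK
  have hI := h210 P hPd hPL k hk1 hkK
  subst hPd hPL
  have hε := P.eps_pos
  have hεd : 0 < (P.eps ^ P.d)⁻¹ := by positivity
  intro j x b
  have hs := P.spacing_pos j
  have hLj : 0 < (P.L : ℝ) ^ j := pow_pos P.cast_L_pos j
  have hsr : 0 < P.spacing j ^ ((3 : ℝ) - (P.d : ℝ)) := Real.rpow_pos_of_pos hs _
  show (P.eps ^ P.d)⁻¹ * |gsumT P a msq k j x b|
    ≤ (P.d : ℝ) * (P.L : ℝ) * C * Real.exp (δ₁ * P.L) * P.spacing j ^ ((3 : ℝ) - (P.d : ℝ))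
        * Real.exp (-(δ₁ * (P.spacing j)⁻¹ * distBlockT P j x b))
  rcases Nat.lt_or_ge j k with hjk | hkj
  · -- `j < k ≤ K`: the contour `Γ^{(j+1)}` sits at admissible levels `j + 1 ≤ m + K`
    have hjm : j + 1 ≤ P.m + P.K := by omega
    -- the value clause of (2.10) on the torus, at each bond of the contour
    have hval : ∀ z y : Site P 0, (P.eps ^ P.d)⁻¹ * |pieceT P a msq k j z y|
        ≤ C * P.spacing j ^ ((2 : ℝ) - (P.d : ℝ)) * Real.exp (-(δ₁ * (T P 0 z y / (P.L : ℝ) ^ j))) := by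
      intro z y
      have h : (P.eps ^ P.d)⁻¹ * |pieceT P a msq k j z y| ≤ C * P.spacing j ^ ((2 : ℝ) - (P.d : ℝ))
          * Real.exp (-(δ₁ * (P.spacing j)⁻¹ * (P.eps * T P 0 z y))) := (hI j z y).1
      rwa [mul_assoc δ₁ ((P.spacing j)⁻¹), scale_inv_mul' j] at h
    set E := Real.exp (-(δ₁ * (T P 0 x b.1 / (P.L : ℝ) ^ j))) with hE
    have hE0 : 0 < E := Real.exp_pos _
    -- the bonds are within `L^{j+1} − 1` of `x`: `e^{−δ₁|z−x_b|_T/L^j} ≤ e^{δ₁L}e^{−δ₁|x−x_b|_T/L^j}`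
    have hcmp : ∀ b' ∈ contourT P (j + 1) x,
        Real.exp (-(δ₁ * (T P 0 b'.1 b.1 / (P.L : ℝ) ^ j))) ≤ Real.exp (δ₁ * P.L) * E := by
      intro b' hb'
      have hz := T_contourT_le P hjm x hb'
      have htri := T_triangle P 0 x b'.1 b.1
      have hsym := T_symm P 0 x b'.1
      rw [hE, ← Real.exp_add]
      refine Real.exp_le_exp.2 ?_
      have key : T P 0 x b.1 / (P.L : ℝ) ^ j - T P 0 b'.1 b.1 / (P.L : ℝ) ^ j ≤ P.L := by
        rw [← sub_div, div_le_iff₀ hLj]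
        calc T P 0 x b.1 - T P 0 b'.1 b.1 ≤ (P.L : ℝ) ^ (j + 1) - 1 := by linarith
          _ ≤ (P.L : ℝ) * (P.L : ℝ) ^ j := by rw [pow_succ]; linarith
      nlinarith [mul_le_mul_of_nonneg_left key hδ₁.le]
    have hcard : ((contourT P (j + 1) x).card : ℝ) ≤ (P.d : ℝ) * (P.L : ℝ) ^ (j + 1) := by
      exact_mod_cast card_contourT_le P hjm x
    have hdist : E ≤ Real.exp (-(δ₁ * (P.spacing j)⁻¹ * distBlockT P j x b)) := by
      rw [hE]
      refine Real.exp_le_exp.2 (neg_le_neg ?_)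
      rw [mul_assoc]
      refine mul_le_mul_of_nonneg_left ?_ hδ₁.le
      rw [← scale_inv_mul' j]
      exact mul_le_mul_of_nonneg_left (distBlockT_le P j x b) (inv_pos.2 hs).le
    calc (P.eps ^ P.d)⁻¹ * |gsumT P a msq k j x b|
        ≤ (P.eps ^ P.d)⁻¹ * ∑ b' ∈ contourT P (j + 1) x, |P.eps * vecPieceT P a msq k j b' b| :=
          mul_le_mul_of_nonneg_left (Finset.abs_sum_le_sum_abs _ _) hεd.le
      _ = ∑ b' ∈ contourT P (j + 1) x, P.eps * ((P.eps ^ P.d)⁻¹ * |vecPieceT P a msq k j b' b|) := by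
          rw [Finset.mul_sum]
          refine Finset.sum_congr rfl fun b' _ => ?_
          rw [abs_mul, abs_of_nonneg hε.le]; ring
      _ ≤ ∑ b' ∈ contourT P (j + 1) x,
            P.eps * (C * P.spacing j ^ ((2 : ℝ) - (P.d : ℝ)) * (Real.exp (δ₁ * P.L) * E)) := by
          refine Finset.sum_le_sum fun b' hb' => mul_le_mul_of_nonneg_left ?_ hε.le
          calc (P.eps ^ P.d)⁻¹ * |vecPieceT P a msq k j b' b|
              ≤ (P.eps ^ P.d)⁻¹ * |pieceT P a msq k j b'.1 b.1| :=
                mul_le_mul_of_nonneg_left (abs_vecPieceT_le j b' b) hεd.le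
            _ ≤ C * P.spacing j ^ ((2 : ℝ) - (P.d : ℝ)) * Real.exp (-(δ₁ * (T P 0 b'.1 b.1 / (P.L : ℝ) ^ j))) := hval _ _
            _ ≤ _ := mul_le_mul_of_nonneg_left (hcmp b' hb') (by positivity)
      _ = (contourT P (j + 1) x).card * (P.eps * (C * P.spacing j ^ ((2 : ℝ) - (P.d : ℝ)) * (Real.exp (δ₁ * P.L) * E))) := by
          rw [Finset.sum_const, nsmul_eq_mul]
      _ ≤ (P.d : ℝ) * (P.L : ℝ) ^ (j + 1) * (P.eps * (C * P.spacing j ^ ((2 : ℝ) - (P.d : ℝ)) * (Real.exp (δ₁ * P.L) * E))) :=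
          mul_le_mul_of_nonneg_right hcard (by positivity)
      _ = (P.d : ℝ) * (P.L : ℝ) * C * Real.exp (δ₁ * P.L) *
            (P.spacing j * P.spacing j ^ ((2 : ℝ) - (P.d : ℝ))) * E := by
          unfold Params.spacing; ring
      _ = (P.d : ℝ) * (P.L : ℝ) * C * Real.exp (δ₁ * P.L) * P.spacing j ^ ((3 : ℝ) - (P.d : ℝ)) * E := by
          rw [spacing_mul_rpow]
      _ ≤ _ := mul_le_mul_of_nonneg_left hdist (by positivity)
  · -- `j ≥ k`: no piece, the averaged leg vanishes
    rw [gsumT_of_le (hk1.trans hkj) hkj, abs_zero, mul_zero]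
    positivity

/-- **(2.10) AND (2.12) TOGETHER on the averaged-leg torus carrier** ((2.10) from `B3Ineq210ZeroTorus.ineq210_zeroTorus` through
`ineq210_iff_V`). [cite: Balaban1983Higgs3, (2.10), (2.12) p.426] -/
theorem ineq210_and_212_zeroTorusV (d L : ℕ) (hd : 1 ≤ d) (hL : Odd L ∧ 1 < L) {a : ℝ} (ha : 0 < a) {msq : ℝ}
    (hmsq : 0 ≤ msq) :
    ∃ δ₁ C : ℝ, 0 < δ₁ ∧ 0 < C ∧ ∀ (P : Params), P.d = d → P.L = L →
      ∀ k : ℕ, 1 ≤ k → k ≤ P.K →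
        (zeroTorusKernelsV P a msq k).Ineq210 δ₁ C ∧ (zeroTorusKernelsV P a msq k).Ineq212 δ₁ C := by
  obtain ⟨δa, Ca, hδa, hCa, ha'⟩ := ineq210_zeroTorus d L hd hL ha hmsq
  obtain ⟨δb, Cb, hδb, hCb, hb'⟩ := ineq212_zeroTorusV d L hd hL ha hmsq
  refine ⟨min δa δb, max Ca Cb, lt_min hδa hδb, lt_max_of_lt_left hCa, fun P hPd hPL k hk1 hkK => ⟨?_, ?_⟩⟩
  · have h := ha' P hPd hPL k hk1 hkK
    rw [ineq210_iff_V]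
    intro j x x'
    obtain ⟨h1, h2⟩ := h j x x'
    have hsc : 0 < (zeroTorusKernels P a msq k).scale j := P.spacing_pos j
    have hdist : 0 ≤ (zeroTorusKernels P a msq k).dist x x' := mul_nonneg P.eps_pos.le (T_nonneg P 0 x x')
    refine ⟨h1.trans ?_, fun μ => (h2 μ).trans ?_⟩
    · refine mul_le_mul (mul_le_mul_of_nonneg_right (le_max_left _ _) (Real.rpow_nonneg hsc.le _))
        (Real.exp_le_exp.2 (neg_le_neg ?_)) (Real.exp_pos _).le (by positivity)
      rw [mul_assoc, mul_assoc]
      exact mul_le_mul_of_nonneg_right (min_le_left _ _) (mul_nonneg (inv_pos.2 hsc).le hdist)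
    · refine mul_le_mul (mul_le_mul_of_nonneg_right (le_max_left _ _) (Real.rpow_nonneg hsc.le _))
        (Real.exp_le_exp.2 (neg_le_neg ?_)) (Real.exp_pos _).le (by positivity)
      rw [mul_assoc, mul_assoc]
      exact mul_le_mul_of_nonneg_right (min_le_left _ _) (mul_nonneg (inv_pos.2 hsc).le hdist)
  · have h := hb' P hPd hPL k hk1 hkK
    intro j x b
    have hsc : 0 < (zeroTorusKernelsV P a msq k).scale j := P.spacing_pos j
    have hdist : 0 ≤ (zeroTorusKernelsV P a msq k).distBlock j x b := by
      show 0 ≤ distBlockT P j x b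
      unfold distBlockT
      refine mul_nonneg P.eps_pos.le (Finset.le_inf' _ _ fun z _ => le_min (T_nonneg P 0 _ _) (T_nonneg P 0 _ _))
    refine (h j x b).trans ?_
    refine mul_le_mul (mul_le_mul_of_nonneg_right (le_max_right _ _) (Real.rpow_nonneg hsc.le _))
      (Real.exp_le_exp.2 (neg_le_neg ?_)) (Real.exp_pos _).le (by positivity)
    rw [mul_assoc, mul_assoc]
    exact mul_le_mul_of_nonneg_right (min_le_right _ _) (mul_nonneg (inv_pos.2 hsc).le hdist)

/-! ## §5 Non-vacuity: the binders are inhabited (`d = 3`, `L = 3`, `a = 1`, `m² = 0`; the volume `m = K = 1`, scale `k = 1`) -/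

/-- The constants exist and (2.12) holds for an explicit torus volume. [cite: Balaban1983Higgs3, (2.12) p.426] -/
theorem ineq212_zeroTorusV_witness :
    ∃ δ₁ C : ℝ, 0 < δ₁ ∧ 0 < C ∧
      (zeroTorusKernelsV (⟨3, 3, 1, 1, by norm_num, ⟨⟨1, by norm_num⟩, by norm_num⟩⟩ : Params) 1 0 1).Ineq212 δ₁ C := by
  obtain ⟨δ₁, C, hδ₁, hC, h⟩ :=
    ineq212_zeroTorusV 3 3 (by norm_num) ⟨⟨1, by norm_num⟩, by norm_num⟩ (a := 1) one_pos (msq := 0) le_rfl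
  exact ⟨δ₁, C, hδ₁, hC, h _ rfl rfl 1 le_rfl le_rfl⟩

end

end Literature.MathematicalPhysics.QuantumFieldTheory.Balaban1983to89.B3Ineq212ZeroTorus
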